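import Summits.NavierStokesRegularity.NavierStokesRegularity.Theses.TautLoopKelvin
import Summits.NavierStokesRegularity.NavierStokesRegularity.Theorems.TautLoopKelvinTautLoopLawDiniSaks
import Summits.NavierStokesRegularity.NavierStokesRegularity.Theorems.TautLoopKelvinTautLoopLawRightLscTransfer
import Summits.NavierStokesRegularity.NavierStokesRegularity.Theorems.TautLoopKelvinTautLoopLawLevelLeftContinuity
import Summits.NavierStokesRegularity.NavierStokesRegularity.Theorems.TautLoopKelvinTautLoopLawSlabRegularity
import Summits.NavierStokesRegularity.NavierStokesRegularity.Theorems.TautLoopKelvinTautLoopLawViscousKelvin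
import Summits.NavierStokesRegularity.NavierStokesRegularity.Theorems.TautLoopKelvinTautLoopLawStepOfSelection
import HarnessLib

/-!
# Line `Sketch-ideas-r1k1` (Dini–Saks architecture) — crux `TautLoopLaw`
# (stmt-NavierStokesRegularity-15249) of route `TautLoopKelvin`

THEOREM L (integrated robust form): for a classical Leray–Hopf solution from a rapidly decaying datum
on `[0,T)`, a level `g > 0`, times `0 ≤ t₁ ≤ t₂ < T` and a measurable majorant `Φ` of the near-taut
compression rate `Λ_g` on `(t₁,t₂)` with `∫ Φ⁺ ≤ M`: `ℓ(g,t₁) · e^{-M} ≤ ℓ(g,t₂)` in `[0,∞]`, where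
`ℓ(g,t) = inf {length C : C a closed C¹ loop, |∮_C u(t)·dl| ≥ g}` (`inf ∅ = ⊤`).

LINE (cards `dini-saks-semicontinuity` + `random-walk-kelvin-selection` / `translation-max-drain`,
ideator 1, round 1). The crux is cut into statements each living at ONE base time, glued by a
Saks-type real-induction lemma in `[0,∞]`:

* `stub_tautLoopDiniSaks` — PURE REAL ANALYSIS (provable now): if `f : ℝ → [0,∞]` is
  right-lower-semicontinuous on `[a,b)` and satisfies the left-Dini step
  `f(t-h) ≤ f(t)·exp(h(Λ(t)+η))` (all `η > 0`, all small `h > 0`) at every `t ∈ (a,b]`, and `Λ ≤ Φ` on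
  `(a,b)` with `Φ` measurable, `∫⁻_{(a,b)} Φ⁺ ≤ M`, then `f(a)·e^{-M} ≤ f(b)` (backward real induction on
  `{s : f s ≤ f b · exp(∫_s^b Ψ + η(b-s) + η)}` with an lsc Vitali–Carathéodory majorant `Ψ > Φ⁺`,
  Mathlib `exists_lt_lowerSemicontinuous_lintegral_ge`; closed under decreasing limits by right-lsc,
  open to the left by the step + lsc of `Ψ`; the extra `η` absorbs the uncontrolled `Λ(b)`).
* `stub_tautLoopRightLscTransfer` — PURE (provable now): right-lsc of `s ↦ ℓ(u s, g)` at `t` follows from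
  sup-norm right-continuity of `s ↦ u s` at `t` and level-left-continuity of `g' ↦ ℓ(u t, g')` at `g`
  (a near-optimal loop at time `s` is admissible at time `t` at level `g - κ·len`; `k`-fold covers handle
  the empty class).
* `stub_tautLoopLevelLeftContinuity` — STATIC GEOMETRY of one `C²` field decaying at infinity (provable,
  heavy): `ℓ(v,g) ≤ sup_{g'<g} ℓ(v,g')` at a nonempty level (confinement + Arzelà–Ascoli of constant-speed
  near-optimal loops + continuity of `Γ` under uniform convergence with bounded lengths (integration by
  parts, `‖∇v‖_∞`) + periodic mollification + exact-level repair: homotopy invariance where `curl v = 0`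
  near the limit loop, else a many-windings lasso at a nearby point with `curl v ≠ 0`, cost
  `2d + O(√(δ/|ω|)) → 0`).
* `stub_tautLoopSlabRegularity` — NS REGULARITY WIRING (classical facts, in-tree: Leray's local regular
  solutions `leray_local_regular_H1_holds`, weak–strong uniqueness `serrin_weak_strong_uniqueness_holds`,
  Tao 2011 Cor. 11.1/11.4 `tao2011_boundedEnstrophy_holds` / `tao_unconditional_uniqueness_velocity_holds`):
  every slice `u t`, `t ∈ [0,T)`, tends to `0` at spatial infinity, and `s ↦ u s` is sup-norm
  right-continuous at every `t ∈ [0,T)`.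
* `stub_tautLoopViscousKelvin` — KELVIN WITH VISCOSITY along material loops (Majda–Bertozzi (1.61);
  LANDED p163926; a supports-helper of the crux, no longer consumed by the composition after the v3
  reshape: the random-walk route uses only the static Weber–Kelvin pull-back identity).
* v3 RESHAPE (2026-08-17, after wave 1 landed stubs 1–5): the exact-level step `stub_tautLoopExactLevelStep`
  is cut into `stub_tautLoopWalkSelection` (6A, classical XL: pull-back of ANY confined bounded-length
  loop from `t` to `t-h` with length factor `exp(h(κ+δ))` and a super-exponentially small circulation
  deficit, by the finite 6-point random-walk Kelvin splitting + first-moment selection) and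
  `stub_tautLoopStepOfSelection` (6B, L: junk guards on the literal `Λ`, confinement of near-taut loops,
  analyticity-fed micro-lasso at `t-h`, exp-algebra), composed as 6B 6A.
* `TautLoopLaw_of : TautLoopLaw` — the crux BY NAME: `DiniSaks` with `f s := ℓ(u s, g)`,
  `Λ s := Λ_g(s)` (the crux's literal `⨅ ε, sSup` expression), right-lsc on `[t₁,t₂)` from
  Transfer ∘ (SlabRegularity, LevelLeftContinuity), the step on `(t₁,t₂]` from StepFromSelection ∘ RandomWalkSelection (v3).

Disproof used: none exists for this crux on 2026-08-17 (`ledger crux ls`: Ideas ×5, Lines/birth.* only;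
payload disproof_path not materialised). Versus the registered birth line (`Lines/birth.lean`, not dead):
its `stub_finiteRelaxedLaw` (conclusion at relaxed levels `g' < g`) is implied by the crux but its sketched
proof needs `Λ_{g'}` at levels the hypothesis does not control (cards path-space / dini-saks); here the
level is exact at every step and level-left-continuity is used only at single times inside right-lsc.
-/

set_option linter.dupNamespace false

noncomputable section

open Literature.Analysis.FluidPDE MeasureTheory Set Function Filter
open scoped ENNReal NNReal Topology InnerProductSpace RealInnerProductSpace

namespace Summit.NavierStokesRegularity.NavierStokesRegularity.Cruxes.TautLoopLaw.DiniSaks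

open Summit.NavierStokesRegularity.NavierStokesRegularity.Theorems

/-! ## The registered stubs (two open after the v3 reshape: 6A, 6B; five landed and imported) -/

/-! Stubs 1–5 have LANDED (wave 1, 2026-08-17) and are imported from `…Theorems.TautLoopKelvinTautLoopLaw*`:
`stub_tautLoopDiniSaks` (p160146), `stub_tautLoopRightLscTransfer` (p160493), `stub_tautLoopLevelLeftContinuity`
(p162655; tools p161746, p162025, p162361), `stub_tautLoopSlabRegularity` (p163294), `stub_tautLoopViscousKelvin`
(p163926), all in `namespace Summit.NavierStokesRegularity.NavierStokesRegularity.Theorems`. -/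

/-- **Stub 6A — RANDOM-WALK KELVIN SELECTION (classical but XL; the pull-back half of the
exact-level step).** For the crux's solution class, a base time `t ∈ (0,T)`, a confinement radius
`R`, a length budget `L` and a slack `δ > 0` there is `h₀ > 0` such that for every `h ∈ (0,h₀)` and
every closed `C¹` loop `γ` inside the closed ball of radius `R` with length `≤ L` there is a closed
`C¹` loop `γ'` inside the ball of radius `R+1`, of length `≤ len γ · exp(h·(κ(γ, u t) + δ))` (`κ` = the
crux's literal mean tangential compression functional of `γ` in the slice `u t`), carrying at time
`t-h` the circulation of `γ` at time `t` up to a SUPER-POLYNOMIALLY small deficit: for every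
prescribed `M : ℕ`, `|Γ(u t, γ)| - h^M ≤ |Γ(u(t-h), γ')|` (v4: the v3 form `e^{-1/h}` was too specific —
the bulk tail of a walk confined to radius `λ(h) → 0` is `e^{-λ²/(36νh)}`, super-polynomial but not `e^{-1/h}`). Mechanism (card random-walk-kelvin-selection, made
finite): Lie–Trotter splitting of the linear 1-form advection–diffusion equation modulo gradients
(exact transport by the backward flow over `τ = h/n`, then the 6-point coordinate average
`M_a f = ⅙ Σ f(· ± a eᵢ)`, `a² = 6ντ`), consistency `O(τ²)` against `u` through the NS equation (the
pressure and `∇|u|²/2` are gradients, killed by circulation), sup-norm stability, `n = n(h) = O(h^{-M})`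
(order: average first, then transport — `θ_{k+1} := T_k (M_a θ_k)`, so only `D⁴u` and first flow derivatives enter);
the scheme's circulation is the AVERAGE over `6ⁿ` deterministic deformed loops at time `t-h`
(Weber–Kelvin pull-back + translations), a mean is at most a max, and the paths whose partial sums
leave the `h^{1/3}`-ball are a fraction `≤ 12e^{-h^{-1/3}/(36ν)}` (reflection + Hoeffding); on the
bulk the length is `len γ·(1 + h(κ + O(h^{1/3})))`. [Constantin–Iyer arXiv:math/0511067 Prop. 2.10
(continuum form); Majda–Bertozzi 2002 §1.6; Beale–Majda 1981 (viscous splitting); folklore] -/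
theorem stub_tautLoopWalkSelection :
    ∀ (ν T : ℝ), 0 < ν → 0 < T → ∀ (u : ℝ → EuclideanSpace ℝ (Fin 3) → EuclideanSpace ℝ (Fin 3)) (p : ℝ → EuclideanSpace ℝ (Fin 3) → ℝ), Literature.Analysis.FluidPDE.IsClassicalNSSolutionOn (Set.Ico 0 T) ν 0 u p → Literature.Analysis.FluidPDE.IsLerayHopfOn T ν 0 (u 0) u → Literature.Analysis.FluidPDE.HasRapidSpatialDecay (u 0) → ∀ t : ℝ, 0 < t → t < T → ∀ R L δ : ℝ, ∀ M : ℕ, 0 < R → 0 < L → 0 < δ → ∃ h₀ : ℝ, 0 < h₀ ∧ ∀ h : ℝ, 0 < h → h < h₀ → ∀ γ : ℝ → EuclideanSpace ℝ (Fin 3), Literature.Analysis.FluidPDE.IsC1Loop γ → (∀ σ, ‖γ σ‖ ≤ R) → (∫ σ in (0:ℝ)..1, ‖deriv γ σ‖) ≤ L → ∃ γ' : ℝ → EuclideanSpace ℝ (Fin 3), Literature.Analysis.FluidPDE.IsC1Loop γ' ∧ (∀ σ, ‖γ' σ‖ ≤ R + 1) ∧ (∫ σ in (0:ℝ)..1,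 ‖deriv γ' σ‖) ≤ (∫ σ in (0:ℝ)..1, ‖deriv γ σ‖) * Real.exp (h * (((∫ σ in (0:ℝ)..1, -(inner ℝ (deriv γ σ) (fderiv ℝ (u t) (γ σ) (deriv γ σ))) / ‖deriv γ σ‖) / (∫ σ in (0:ℝ)..1, ‖deriv γ σ‖)) + δ)) ∧ |Literature.Analysis.FluidPDE.circulation (u t) γ| - h ^ M ≤ |Literature.Analysis.FluidPDE.circulation (u (t - h)) γ'| := by
  sorry

/-! Stub 6B `stub_tautLoopStepOfSelection` has LANDED (wave 4, p171263 + aux p171036) and is imported from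
`…Theorems.TautLoopKelvinTautLoopLawStepOfSelection`; the only open stub is 6A `stub_tautLoopWalkSelection`. -/

/-! ## The composition: the crux BY NAME from the stubs (real proof) -/

/-- Notation (proof-side only; the registered stub signatures above are written out in full):
`ℓ⟦v, g⟧` = the circulation–length spectrum of the field `v` at level `g`, in `ℝ≥0∞`. -/
local notation3 "ℓ⟦" v ", " g "⟧" => (⨅ (γ' : ℝ → EuclideanSpace ℝ (Fin 3)) (_ : Literature.Analysis.FluidPDE.IsC1Loop γ' ∧ g ≤ |Literature.Analysis.FluidPDE.circulation v γ'|), ENNReal.ofReal (∫ σ in (0:ℝ)..1, ‖deriv γ' σ‖))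

/-- Notation (proof-side only): `Λ⟦v, g⟧` = the crux's near-taut compression rate of `v` at level `g`. -/
local notation3 "Λ⟦" v ", " g "⟧" => (⨅ ε : {ε : ℝ // 0 < ε}, sSup {k : ℝ | ∃ γ : ℝ → EuclideanSpace ℝ (Fin 3), Literature.Analysis.FluidPDE.IsC1Loop γ ∧ g ≤ |Literature.Analysis.FluidPDE.circulation v γ| ∧ ENNReal.ofReal (∫ σ in (0:ℝ)..1, ‖deriv γ σ‖) ≤ ℓ⟦v, g⟧ + ENNReal.ofReal (ε : ℝ) ∧ k = ((∫ σ in (0:ℝ)..1, -(inner ℝ (deriv γ σ) (fderiv ℝ v (γ σ) (deriv γ σ))) / ‖deriv γ σ‖) / (∫ σ in (0:ℝ)..1, ‖deriv γ σ‖))})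

/-- **Skeleton theorem (A12 shape): `TautLoopLaw` BY NAME from the six stubs.** `DiniSaks` with
`f s := ℓ(u s, g)` and `Λ s := Λ_g(s)`; right-lsc on `[t₁,t₂)` from the transfer stub fed by slab
regularity (continuity of slices, sup-norm right-continuity, decay) and static level-left-continuity;
the left-Dini step on `(t₁,t₂]` from the exact-level step = StepFromSelection fed by RandomWalkSelection. -/
theorem TautLoopLaw_of :
    Summit.NavierStokesRegularity.NavierStokesRegularity.Theses.TautLoopKelvin.TautLoopLaw := by
  intro ν T hν hT u p hcl hLH hdec g hg t₁ t₂ ht₁ ht₁₂ ht₂ Φ M hΦ hM hmaj hint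
  obtain ⟨hdecay, hsup⟩ := stub_tautLoopSlabRegularity ν T hν hT u p hcl hLH hdec
  have hcont : ∀ s ∈ Set.Ico 0 T, Continuous (u s) := fun s hs =>
    (hcl.contDiff_velocity hs).continuous
  have hC2 : ∀ s ∈ Set.Ico 0 T, ContDiff ℝ 2 (u s) := fun s hs =>
    (hcl.contDiff_velocity hs).of_le (by norm_cast)
  refine stub_tautLoopDiniSaks (fun s => ℓ⟦u s, g⟧) (fun s => Λ⟦u s, g⟧) Φ t₁ t₂ M ht₁₂ hM hΦ
    (fun s hs => hmaj s hs) hint ?_ ?_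
  · -- right-lower-semicontinuity of the spectrum on `[t₁, t₂)`
    intro t ht
    have htT : t ∈ Set.Ico 0 T := ⟨ht₁.trans ht.1, ht.2.trans ht₂⟩
    have hnear : ∀ᶠ s in nhdsWithin t (Set.Ioi t), Continuous (u s) := by
      have hmem : Set.Ioo t T ∈ nhdsWithin t (Set.Ioi t) := Ioo_mem_nhdsGT htT.2
      filter_upwards [hmem] with s hs
      exact hcont s ⟨htT.1.trans hs.1.le, hs.2⟩
    exact stub_tautLoopRightLscTransfer u t g hg (hcont t htT) hnear (hsup t htT)
      (stub_tautLoopLevelLeftContinuity (u t) (hC2 t htT) (hdecay t htT) g hg)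
  · -- the exact-level left-Dini step on `(t₁, t₂]`
    intro t ht η hη
    exact stub_tautLoopStepOfSelection stub_tautLoopWalkSelection ν T hν hT u p hcl hLH hdec g hg t
      (lt_of_le_of_lt ht₁ ht.1) (lt_of_le_of_lt ht.2 ht₂) η hη

end Summit.NavierStokesRegularity.NavierStokesRegularity.Cruxes.TautLoopLaw.DiniSaks

end
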